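import Summits.HodgeConjecture.CorCM.D2Bridge.Thm418CTransport
import HarnessLib

/-!
# Δ2 BRIDGE, PROPOSAL T glue (T0) — `Thm418Combined` ∕ `Thm418C` transport along SEMILINEAR (e.g. ANTILINEAR) maps

Cell pub-hodgecm2 (COR-CM), Δ2 bridge wall-breaker fan, seat wb-11 gen 3 (prover-pub-hodgecm2-d2bridge-wb-11-g3-0), 2026-08-23;
sub-socket S-c TRANSPORT route, in the service of own-crow g93's PROPOSAL T (HOME/INBOX l.12012, «conjugation TRANSPORT»).

WHAT IS HERE (kernel only; no instance, no named fact, no new definition, nothing cited anew).  wb-10's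
`D2Bridge/Thm418CTransport.lean` proves that the combined reading r8 `Thm418Combined` ([Liu2021, Thm. 4.18 + (4.3) + Thm. 4.18 (1) +
Lem. 2.4 (1)]) and the model's `LiuDictionary.Thm418C` transport along packages of `ℂ`-LINEAR maps.  PROPOSAL T transports along the
ANTILINEAR involution `F∞ = conj ⊗ id` of `ℂ ⊗_ℚ H¹_B` (same Hermitian space, same tower, same pieces), which the linear package does
not cover.  This file re-proves the whole package for maps that are `σ`-SEMILINEAR over an inverse pair of ring endomorphisms
`σ, σ' : ℂ →+* ℂ` (`[RingHomInvPair σ σ'] [RingHomInvPair σ' σ]`): `σ = σ' = RingHom.id ℂ` is wb-10's case verbatim, and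
`σ = σ' = starRingEnd ℂ` (Mathlib instance `RingHomInvPair (starRingEnd ℂ) (starRingEnd ℂ)`) is the scalar part of `F∞`.

* §1 (abstract, `HodgeCM.Literature.Theta.LiuAlbaneseModuleDatum` currency): `map_mem_fixedBy_of_semilinearMap`,
  `map_oscImage_le_of_semilinearTransport`, `map_block_le_of_semilinearTransport`, `map_block_eq_of_semilinearTransport`,
  `thm418Combined_of_semilinearTransport` (pull-back), `thm418Combined_semilinearTransport_of` (push-forward),
  `thm418Combined_iff_of_semilinearTransport` (equivalence).  THE ONE POINT beyond wb-10's chase: for a `ℂ[G]`-map `ψ : ω(t) → H`, a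
  `σ`-semilinear `eH : H → H'` and a `σ'`-semilinear quotient map `θ : ω(t') → ω(t)`, the composite `eH ∘ ψ ∘ θ : ω(t') → H'` is
  `ℂ`-LINEAR (`RingHomCompTriple σ' σ (RingHom.id ℂ)`), hence a `ℂ[G']`-map by `MonoidAlgebra.equivariantOfLinearOfComm`; so the
  isotypic images and the `μ`-blocks transport exactly as in the linear case, and the `span` ∕ `fixedBy` chase uses
  `Submodule.map_span` ∕ `Submodule.map_iSup` under `RingHomSurjective σ`.
* §2 (model currency): `thm418C_iff_of_semilinearTransport` ∕ `thm418C_of_semilinearTransport` for two real-carrier dictionaries at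
  any two pins, and `thm418C_iff_of_semilinearTransport_samePin` — two dictionaries `T₁ T₂ : LiuDictionary hHD hI h₁ h₃ V` on the SAME
  Hermitian space (e.g. a dictionary and a re-keyed one), `φ = id`, `eL = id`: `T₁.Thm418C ↔ T₂.Thm418C` along a character bijection
  `eC` matching `PhiMu`, a `G`-equivariant `σ`-semilinear automorphism `eH` of the tower matching the blocks, and `σ`-semilinear
  automorphisms `eW K` of `H¹(P_K; ℂ) = ℂ ⊗_ℚ H¹(P_K; ℚ)` intertwining `res` and matching `cmClasses`.

HOW PROPOSAL T PLUGS IN (its sub-lemmas are the BINDERS of `thm418C_iff_of_semilinearTransport_samePin` at `σ = starRingEnd ℂ`; none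
is assumed here): (T1) `F∞` on the tower with the `res` ∕ `fixedBy` laws = `eH`, `eW`, `heH`, `hres`; (T2) the index involution
`i ↦ ī` with `PhiMu i ↔ PhiMu′ ī` = `eC`, `hPhi`; (T3′) record conjugation `cmCl′ ī = F∞ '' cmCl i` = `hcm`; (T4) antilinear
`G`-isomorphisms of the oscillator modules `ω(i,a) ≃ₛₗ[conj] ω(ī, ā)` ⇒ `hblock`, by `map_block_eq_of_semilinearTransport`.
The theorem is ORIENTATION-NEUTRAL infrastructure; HC_CM is NOT proved; «Δ2 BRIDGE CLOSED» is NOT claimed.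

## References
* [Liu2021] Y. Liu, *Fourier–Jacobi cycles and arithmetic relative trace formula*, Camb. J. Math. 9 (2021) = arXiv:2102.11518 —
  Thm. 4.18 (FJcycle.tex l. 2232–2245), its proof map (4.3), Prop. 4.13.
-/

set_option autoImplicit false

noncomputable section

namespace HodgeCM.Literature.Theta.LiuAlbaneseModuleDatum.D2Bridge

open HodgeCM.Literature.Theta HodgeCM.Literature.Theta.LiuAlbaneseModuleDatum

universe u v w u' v' w'

/-! ## §1 Abstract transport of `Thm418Combined` along semilinear maps -/

section AbstractSemilinear

/-- **Fixed vectors transport (semilinear).**  A `σ`-semilinear map `f : M → M'` from a `ℂ[G]`-module to a `ℂ[G']`-module which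
intertwines the actions along `φ` on a subgroup `K ≤ G` (`f (k • x) = φ k • f x`, `k ∈ K`) maps `K`-fixed vectors to `K'`-fixed
vectors for every `K' ≤ G'` covered by `φ(K)`. [folklore] -/
theorem map_mem_fixedBy_of_semilinearMap {σ : ℂ →+* ℂ} {G : Type u} [Group G] {G' : Type u'} [Group G']
    {M : Type v} [AddCommGroup M] [Module ℂ M] [Module (MonoidAlgebra ℂ G) M] [IsScalarTower ℂ (MonoidAlgebra ℂ G) M]
    {M' : Type v'} [AddCommGroup M'] [Module ℂ M'] [Module (MonoidAlgebra ℂ G') M']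
    [IsScalarTower ℂ (MonoidAlgebra ℂ G') M']
    (φ : G → G') (f : M →ₛₗ[σ] M') {K : Subgroup G} {K' : Subgroup G'}
    (hK : ∀ k' ∈ K', ∃ k ∈ K, φ k = k')
    (hf : ∀ k ∈ K, ∀ x : M, f (MonoidAlgebra.of ℂ G k • x) = MonoidAlgebra.of ℂ G' (φ k) • f x)
    {x : M} (hx : x ∈ fixedBy K M) : f x ∈ fixedBy K' M' := by
  intro k' hk'
  obtain ⟨k, hk, rfl⟩ := hK k' hk'
  rw [← hf k hk x, hx k hk]

variable {σ σ' : ℂ →+* ℂ} [RingHomInvPair σ σ'] [RingHomInvPair σ' σ]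
variable {G : Type u} [Group G] {Lvl : Type v} {Kof : Lvl → Subgroup G}
variable {G' : Type u'} [Group G'] {Lvl' : Type v'} {Kof' : Lvl' → Subgroup G'}

omit [RingHomInvPair σ' σ] in
/-- **Isotypic images transport (semilinear).**  Along a group isomorphism `φ : G ≃* G'` and a `φ`-intertwining `σ`-semilinear map
`eH : H → H'`, the sum `oscImage t` of the equivariant images of `ω(t)` in `H` is carried into `oscImage t'` as soon as `ω(t')` maps
`φ⁻¹`-intertwiningly and `σ'`-semilinearly ONTO `ω(t)` (`θ`): for every `ℂ[G]`-map `ψ : ω(t) → H` the composite `eH ∘ ψ ∘ θ` is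
`ℂ`-LINEAR (`σ ∘ σ' = id`) and commutes with `G'`, so it is a `ℂ[G']`-map `ω(t') → H'` with the same image. [folklore] -/
theorem map_oscImage_le_of_semilinearTransport (D : LiuAlbaneseModuleDatum G Kof) (D' : LiuAlbaneseModuleDatum G' Kof')
    (φ : G ≃* G') (eH : D.H →ₛₗ[σ] D'.H)
    (heH : ∀ (g : G) (x : D.H), eH (MonoidAlgebra.of ℂ G g • x) = MonoidAlgebra.of ℂ G' (φ g) • eH x)
    (t : D.Triple) (t' : D'.Triple) (θ : D'.Ωt t' →ₛₗ[σ'] D.Ωt t) (hθ : Function.Surjective θ)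
    (hθG : ∀ (g' : G') (y : D'.Ωt t'),
      θ (MonoidAlgebra.of ℂ G' g' • y) = MonoidAlgebra.of ℂ G (φ.symm g') • θ y) :
    (D.oscImage t).map eH ≤ D'.oscImage t' := by
  unfold oscImage
  rw [Submodule.map_iSup]
  refine iSup_le fun ψ => ?_
  have hcomm : ∀ (g' : G') (y : D'.Ωt t'),
      (eH.comp ((ψ.restrictScalars ℂ).comp θ) : D'.Ωt t' →ₗ[ℂ] D'.H) (MonoidAlgebra.single g' (1 : ℂ) • y) =
        MonoidAlgebra.single g' (1 : ℂ) • (eH.comp ((ψ.restrictScalars ℂ).comp θ) : D'.Ωt t' →ₗ[ℂ] D'.H) y := by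
    intro g' y
    simp only [LinearMap.coe_comp, Function.comp_apply, LinearMap.coe_restrictScalars]
    rw [← MonoidAlgebra.of_apply, hθG, map_smul, heH, MulEquiv.apply_symm_apply]
  refine le_trans ?_ (le_iSup (fun ψ' : D'.Ωt t' →ₗ[MonoidAlgebra ℂ G'] D'.H => (LinearMap.range ψ').restrictScalars ℂ)
    (MonoidAlgebra.equivariantOfLinearOfComm (eH.comp ((ψ.restrictScalars ℂ).comp θ) : D'.Ωt t' →ₗ[ℂ] D'.H) hcomm))
  rintro _ ⟨y, hy, rfl⟩
  obtain ⟨z, rfl⟩ : ∃ z, ψ z = y := hy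
  obtain ⟨w, rfl⟩ := hθ z
  exact ⟨w, rfl⟩

omit [RingHomInvPair σ' σ] in
/-- **Blocks transport (semilinear, one-sided).**  `eH (block μ) ≤ block' μ'` as soon as every `ω(μ, a)` is a `φ⁻¹`-intertwining
`σ'`-semilinear QUOTIENT of some `ω(μ', a')`. [folklore] -/
theorem map_block_le_of_semilinearTransport (D : LiuAlbaneseModuleDatum G Kof) (D' : LiuAlbaneseModuleDatum G' Kof')
    (φ : G ≃* G') (eH : D.H →ₛₗ[σ] D'.H)
    (heH : ∀ (g : G) (x : D.H), eH (MonoidAlgebra.of ℂ G g • x) = MonoidAlgebra.of ℂ G' (φ g) • eH x)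
    (μ : D.Char) (μ' : D'.Char)
    (hΩ : ∀ a : D.Adm μ, ∃ (a' : D'.Adm μ') (θ : D'.Ω μ' a' →ₛₗ[σ'] D.Ω μ a), Function.Surjective θ ∧
      ∀ (g' : G') (y : D'.Ω μ' a'), θ (MonoidAlgebra.of ℂ G' g' • y) = MonoidAlgebra.of ℂ G (φ.symm g') • θ y) :
    (D.block μ).map eH ≤ D'.block μ' := by
  unfold block
  rw [Submodule.map_iSup]
  refine iSup_le fun a => ?_
  obtain ⟨a', θ, hθ, hθG⟩ := hΩ a
  exact le_trans (map_oscImage_le_of_semilinearTransport D D' φ eH heH ⟨μ, a⟩ ⟨μ', a'⟩ θ hθ hθG)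
    (le_iSup (fun b : D'.Adm μ' => D'.oscImage ⟨μ', b⟩) a')

/-- **Blocks transport (semilinear, two-sided).**  Along `φ : G ≃* G'`, a `φ`-intertwining `σ`-semilinear ISOMORPHISM `eH : H ≃ H'`, a
bijection of the admissible completions `eA : Adm μ ≃ Adm' μ'` and `φ`-intertwining `σ`-semilinear isomorphisms
`eΩ a : ω(μ, a) ≃ ω(μ', eA a)`, the `μ`-block of `H` is carried ONTO the `μ'`-block of `H'`. [folklore] -/
theorem map_block_eq_of_semilinearTransport (D : LiuAlbaneseModuleDatum G Kof) (D' : LiuAlbaneseModuleDatum G' Kof')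
    (φ : G ≃* G') (eH : D.H ≃ₛₗ[σ] D'.H)
    (heH : ∀ (g : G) (x : D.H), eH (MonoidAlgebra.of ℂ G g • x) = MonoidAlgebra.of ℂ G' (φ g) • eH x)
    (μ : D.Char) (μ' : D'.Char) (eA : D.Adm μ ≃ D'.Adm μ')
    (eΩ : ∀ a : D.Adm μ, D.Ω μ a ≃ₛₗ[σ] D'.Ω μ' (eA a))
    (heΩ : ∀ (a : D.Adm μ) (g : G) (y : D.Ω μ a),
      eΩ a (MonoidAlgebra.of ℂ G g • y) = MonoidAlgebra.of ℂ G' (φ g) • eΩ a y) :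
    (D.block μ).map (eH : D.H →ₛₗ[σ] D'.H) = D'.block μ' := by
  apply le_antisymm
  · refine map_block_le_of_semilinearTransport D D' φ (eH : D.H →ₛₗ[σ] D'.H) (fun g x => heH g x) μ μ'
      fun a => ⟨eA a, ((eΩ a).symm : D'.Ω μ' (eA a) →ₛₗ[σ'] D.Ω μ a), (eΩ a).symm.surjective, fun g' y => ?_⟩
    change (eΩ a).symm _ = _ • (eΩ a).symm y
    apply (eΩ a).injective
    rw [LinearEquiv.apply_symm_apply, heΩ, MulEquiv.apply_symm_apply, LinearEquiv.apply_symm_apply]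
  · have hsymm : ∀ (g' : G') (x' : D'.H), (eH.symm : D'.H →ₛₗ[σ'] D.H) (MonoidAlgebra.of ℂ G' g' • x') =
        MonoidAlgebra.of ℂ G (φ.symm g') • (eH.symm : D'.H →ₛₗ[σ'] D.H) x' := by
      intro g' x'
      change eH.symm _ = _ • eH.symm x'
      apply eH.injective
      rw [LinearEquiv.apply_symm_apply, heH, MulEquiv.apply_symm_apply, LinearEquiv.apply_symm_apply]
    have h1 : (D'.block μ').map (eH.symm : D'.H →ₛₗ[σ'] D.H) ≤ D.block μ := by
      refine map_block_le_of_semilinearTransport D' D φ.symm (eH.symm : D'.H →ₛₗ[σ'] D.H) hsymm μ' μ fun a' => ?_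
      obtain ⟨a, rfl⟩ := eA.surjective a'
      refine ⟨a, (eΩ a : D.Ω μ a →ₛₗ[σ] D'.Ω μ' (eA a)), (eΩ a).surjective, fun g y => ?_⟩
      change eΩ a _ = _ • eΩ a y
      rw [heΩ, MulEquiv.symm_symm]
    intro x' hx'
    exact ⟨eH.symm x', h1 ⟨x', hx', rfl⟩, eH.apply_symm_apply x'⟩

omit [RingHomInvPair σ' σ] in
/-- **`Thm418Combined` transports along semilinear maps (pull-back form, weakest hypotheses).**  If `D'` satisfies the combined
reading r8 for `(res', cmCl')`, so does `D` for `(res, cmCl)`, along any package `D → D'`: `φ : G → G'` covering `Kof' (eL K)` by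
`φ (Kof K)`, a cofinal `eL : Lvl → Lvl'`, `eC : Char → Char'` preserving `PhiMu`, a `σ`-semilinear `eH : H → H'` intertwining along `φ`
on each `Kof K` and carrying `block μ` into `block' (eC μ)`, and injective `σ`-semilinear `eW K : W K → W' (eL K)` with
`eW K ∘ res K = res' (eL K) ∘ eH` and `cmCl' (eL K) (eC μ) ⊆ eW K '' cmCl K μ`.  PROOF: chase one vector; `Submodule.map_span` for a
semilinear map under `RingHomSurjective σ`. [folklore] -/
theorem thm418Combined_of_semilinearTransport [Preorder Lvl] [Preorder Lvl']
    (D : LiuAlbaneseModuleDatum G Kof) (D' : LiuAlbaneseModuleDatum G' Kof')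
    {W : Lvl → Type w} [∀ K, AddCommGroup (W K)] [∀ K, Module ℂ (W K)]
    {W' : Lvl' → Type w'} [∀ K', AddCommGroup (W' K')] [∀ K', Module ℂ (W' K')]
    (res : ∀ K : Lvl, D.H →ₗ[ℂ] W K) (cmCl : ∀ K : Lvl, D.Char → Set (W K))
    (res' : ∀ K' : Lvl', D'.H →ₗ[ℂ] W' K') (cmCl' : ∀ K' : Lvl', D'.Char → Set (W' K'))
    (φ : G → G') (eL : Lvl → Lvl') (eC : D.Char → D'.Char) (eH : D.H →ₛₗ[σ] D'.H)
    (eW : ∀ K : Lvl, W K →ₛₗ[σ] W' (eL K))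
    (hcof : ∀ K₀' : Lvl', ∃ K₀ : Lvl, ∀ K ≤ K₀, eL K ≤ K₀')
    (hK : ∀ (K : Lvl), ∀ k' ∈ Kof' (eL K), ∃ k ∈ Kof K, φ k = k')
    (heH : ∀ (K : Lvl), ∀ k ∈ Kof K, ∀ x : D.H,
      eH (MonoidAlgebra.of ℂ G k • x) = MonoidAlgebra.of ℂ G' (φ k) • eH x)
    (hPhi : ∀ μ : D.Char, D.PhiMu μ → D'.PhiMu (eC μ))
    (hblock : ∀ μ : D.Char, (D.block μ).map eH ≤ D'.block (eC μ))
    (hres : ∀ (K : Lvl) (x : D.H), eW K (res K x) = res' (eL K) (eH x))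
    (hW : ∀ K : Lvl, Function.Injective (eW K))
    (hcm : ∀ (K : Lvl) (μ : D.Char), cmCl' (eL K) (eC μ) ⊆ eW K '' cmCl K μ)
    (h : D'.Thm418Combined res' cmCl') : D.Thm418Combined res cmCl := by
  intro μ hμ
  obtain ⟨K₀', hK₀'⟩ := h (eC μ) (hPhi μ hμ)
  obtain ⟨K₀, hK₀⟩ := hcof K₀'
  refine ⟨K₀, fun K hKle x hxb hxf => ?_⟩
  have h1 : eH x ∈ D'.block (eC μ) := hblock μ ⟨x, hxb, rfl⟩
  have h2 : eH x ∈ fixedBy (Kof' (eL K)) D'.H := map_mem_fixedBy_of_semilinearMap φ eH (hK K) (heH K) hxf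
  have h3 : eW K (res K x) ∈ (Submodule.span ℂ (cmCl K μ)).map (eW K) := by
    rw [Submodule.map_span, hres]
    exact Submodule.span_mono (hcm K μ) (hK₀' (eL K) (hK₀ K hKle) (eH x) h1 h2)
  obtain ⟨y, hy, hyx⟩ := h3
  rwa [← hW K hyx]

/-- **`Thm418Combined` transports along semilinear maps (push-forward form).**  If `D` satisfies the combined reading r8 for
`(res, cmCl)`, so does `D'` for `(res', cmCl')`, along `φ : G → G'` with `φ (Kof K) ≤ Kof' (eL K)`, an order ISOMORPHISM of levels `eL`,
a SURJECTION of characters `eC` reflecting `PhiMu`, a `σ`-semilinear ISOMORPHISM `eH` intertwining along `φ` on each `Kof K` with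
`block' (eC μ) ≤ eH (block μ)`, and `σ`-semilinear `eW K` with `eW K ∘ res K = res' (eL K) ∘ eH`, `eW K '' cmCl K μ ⊆ cmCl' (eL K) (eC μ)`.
[folklore] -/
theorem thm418Combined_semilinearTransport_of [Preorder Lvl] [Preorder Lvl']
    (D : LiuAlbaneseModuleDatum G Kof) (D' : LiuAlbaneseModuleDatum G' Kof')
    {W : Lvl → Type w} [∀ K, AddCommGroup (W K)] [∀ K, Module ℂ (W K)]
    {W' : Lvl' → Type w'} [∀ K', AddCommGroup (W' K')] [∀ K', Module ℂ (W' K')]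
    (res : ∀ K : Lvl, D.H →ₗ[ℂ] W K) (cmCl : ∀ K : Lvl, D.Char → Set (W K))
    (res' : ∀ K' : Lvl', D'.H →ₗ[ℂ] W' K') (cmCl' : ∀ K' : Lvl', D'.Char → Set (W' K'))
    (φ : G → G') (eL : Lvl ≃o Lvl') (eC : D.Char → D'.Char) (hC : Function.Surjective eC)
    (eH : D.H ≃ₛₗ[σ] D'.H) (eW : ∀ K : Lvl, W K →ₛₗ[σ] W' (eL K))
    (hK : ∀ (K : Lvl), ∀ k ∈ Kof K, φ k ∈ Kof' (eL K))
    (heH : ∀ (K : Lvl), ∀ k ∈ Kof K, ∀ x : D.H,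
      eH (MonoidAlgebra.of ℂ G k • x) = MonoidAlgebra.of ℂ G' (φ k) • eH x)
    (hPhi : ∀ μ : D.Char, D'.PhiMu (eC μ) → D.PhiMu μ)
    (hblock : ∀ μ : D.Char, D'.block (eC μ) ≤ (D.block μ).map (eH : D.H →ₛₗ[σ] D'.H))
    (hres : ∀ (K : Lvl) (x : D.H), eW K (res K x) = res' (eL K) (eH x))
    (hcm : ∀ (K : Lvl) (μ : D.Char), eW K '' cmCl K μ ⊆ cmCl' (eL K) (eC μ))
    (h : D.Thm418Combined res cmCl) : D'.Thm418Combined res' cmCl' := by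
  intro μ' hμ'
  obtain ⟨μ, rfl⟩ := hC μ'
  obtain ⟨K₀, hK₀⟩ := h μ (hPhi μ hμ')
  refine ⟨eL K₀, fun K' hK'le x' hxb' hxf' => ?_⟩
  obtain ⟨K, rfl⟩ := eL.surjective K'
  obtain ⟨x, rfl⟩ := eH.surjective x'
  have hKle : K ≤ K₀ := eL.le_iff_le.mp hK'le
  have hxb : x ∈ D.block μ := by
    obtain ⟨y, hy, hyx⟩ := hblock μ hxb'
    rwa [← eH.injective hyx]
  have hxf : x ∈ fixedBy (Kof K) D.H := by
    intro k hk
    apply eH.injective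
    rw [heH K k hk]
    exact hxf' (φ k) (hK K k hk)
  have h3 : eW K (res K x) ∈ (Submodule.span ℂ (cmCl K μ)).map (eW K) := ⟨_, hK₀ K hKle x hxb hxf, rfl⟩
  rw [Submodule.map_span, hres] at h3
  exact Submodule.span_mono (hcm K μ) h3

/-- **`Thm418Combined` is INVARIANT under semilinear transport of all its data** (the two forms combined): along a group isomorphism
`φ : G ≃* G'` with `Kof' (eL K) = φ (Kof K)`, an order isomorphism of levels `eL`, a bijection of characters `eC` with
`PhiMu μ ↔ PhiMu' (eC μ)`, a `φ`-intertwining `σ`-semilinear isomorphism of carriers `eH` with `eH (block μ) = block' (eC μ)` (e.g. from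
`map_block_eq_of_semilinearTransport`), and `σ`-semilinear isomorphisms `eW K : W K ≃ W' (eL K)` with `eW K ∘ res K = res' (eL K) ∘ eH`
and `cmCl' (eL K) (eC μ) = eW K '' cmCl K μ`: `D.Thm418Combined res cmCl ↔ D'.Thm418Combined res' cmCl'`.  At `σ = starRingEnd ℂ`
this is the shape of PROPOSAL T (`eH = F∞`). [folklore] -/
theorem thm418Combined_iff_of_semilinearTransport [Preorder Lvl] [Preorder Lvl']
    (D : LiuAlbaneseModuleDatum G Kof) (D' : LiuAlbaneseModuleDatum G' Kof')
    {W : Lvl → Type w} [∀ K, AddCommGroup (W K)] [∀ K, Module ℂ (W K)]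
    {W' : Lvl' → Type w'} [∀ K', AddCommGroup (W' K')] [∀ K', Module ℂ (W' K')]
    (res : ∀ K : Lvl, D.H →ₗ[ℂ] W K) (cmCl : ∀ K : Lvl, D.Char → Set (W K))
    (res' : ∀ K' : Lvl', D'.H →ₗ[ℂ] W' K') (cmCl' : ∀ K' : Lvl', D'.Char → Set (W' K'))
    (φ : G ≃* G') (eL : Lvl ≃o Lvl') (eC : D.Char ≃ D'.Char) (eH : D.H ≃ₛₗ[σ] D'.H)
    (eW : ∀ K : Lvl, W K ≃ₛₗ[σ] W' (eL K))
    (hK : ∀ K : Lvl, Kof' (eL K) = (Kof K).map φ.toMonoidHom)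
    (heH : ∀ (g : G) (x : D.H), eH (MonoidAlgebra.of ℂ G g • x) = MonoidAlgebra.of ℂ G' (φ g) • eH x)
    (hPhi : ∀ μ : D.Char, D.PhiMu μ ↔ D'.PhiMu (eC μ))
    (hblock : ∀ μ : D.Char, (D.block μ).map (eH : D.H →ₛₗ[σ] D'.H) = D'.block (eC μ))
    (hres : ∀ (K : Lvl) (x : D.H), eW K (res K x) = res' (eL K) (eH x))
    (hcm : ∀ (K : Lvl) (μ : D.Char), cmCl' (eL K) (eC μ) = eW K '' cmCl K μ) :
    D.Thm418Combined res cmCl ↔ D'.Thm418Combined res' cmCl' := by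
  constructor
  · refine thm418Combined_semilinearTransport_of D D' res cmCl res' cmCl' φ eL eC eC.surjective eH
      (fun K => (eW K : W K →ₛₗ[σ] W' (eL K))) (fun K k hk => ?_) (fun K k _ x => heH k x)
      (fun μ => (hPhi μ).2) (fun μ => (hblock μ).ge) (fun K x => hres K x) (fun K μ => (hcm K μ).ge)
    rw [hK K]
    exact ⟨k, hk, rfl⟩
  · refine thm418Combined_of_semilinearTransport D D' res cmCl res' cmCl' φ eL eC (eH : D.H →ₛₗ[σ] D'.H)
      (fun K => (eW K : W K →ₛₗ[σ] W' (eL K))) (fun K₀' => ⟨eL.symm K₀', fun K hK => ?_⟩) (fun K k' hk' => ?_)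
      (fun K k _ x => heH k x) (fun μ => (hPhi μ).1) (fun μ => (hblock μ).le) (fun K x => hres K x)
      (fun K => (eW K).injective) (fun K μ => (hcm K μ).le)
    · simpa using eL.monotone hK
    · rw [hK K] at hk'
      obtain ⟨k, hk, rfl⟩ := hk'
      exact ⟨k, hk, rfl⟩

end AbstractSemilinear

end HodgeCM.Literature.Theta.LiuAlbaneseModuleDatum.D2Bridge

/-! ## §2 The model's dictionaries: `Thm418C` transports along semilinear packages -/

namespace Summit.HodgeConjecture.CorCM.D2Bridge

open HodgeCM HodgeCM.Model
open HodgeCM.Literature.Theta HodgeCM.Literature.Theta.LiuAlbaneseModuleDatum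
open HodgeCM.Literature.Theta.LiuAlbaneseModuleDatum.D2Bridge

variable {σ σ' : ℂ →+* ℂ} [RingHomInvPair σ σ'] [RingHomInvPair σ' σ]
variable {hHD : Literature.AlgebraicGeometry.HodgeTheory.exists_isReal_hodgeModel}
  {hI : Literature.AlgebraicGeometry.HodgeTheory.hodgePQ_independent_of_hodgeModel}
  {h₁ : Literature.NumberTheory.Automorphic.PicardCM.BallQuotientUniformised}
  {h₃ : Literature.NumberTheory.Automorphic.PicardCM.CMAbelianVarietyRealised}

/-- **`Thm418C` transports along a SEMILINEAR package (two-sided), any two pins.**  For real-carrier dictionaries `T₁`, `T₂` at pins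
`(L₁, ι₁, V₁)`, `(L₂, ι₂, V₂)` of the SAME end-state universe, `T₁.Thm418C ↔ T₂.Thm418C` along: `φ : U(V₁)(𝔸_f) ≃* U(V₂)(𝔸_f)` and an
order isomorphism of levels `eL` with `(eL K).K = φ (K.K)`; a bijection of characters `eC` matching `PhiMu`; a `φ`-intertwining
`σ`-semilinear isomorphism of towers `eH` matching the `μ`-blocks; per-level `σ`-semilinear isomorphisms
`eW K : H¹(P_K(V₁); ℂ) ≃ H¹(P_{eL K}(V₂); ℂ)` intertwining `res` and matching `cmClasses`.  `σ = RingHom.id ℂ` is wb-10's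
`thm418C_iff_of_transport`; `σ = starRingEnd ℂ` is the antilinear case. [folklore] -/
theorem thm418C_iff_of_semilinearTransport {L₁ L₂ : HodgeCM.CMField} {ι₁ : (L₁ : Type) →+* ℂ} {ι₂ : (L₂ : Type) →+* ℂ}
    {V₁ : HodgeCM.HermSpace3 L₁ ι₁} {V₂ : HodgeCM.HermSpace3 L₂ ι₂}
    (T₁ : LiuDictionary hHD hI h₁ h₃ V₁) (T₂ : LiuDictionary hHD hI h₁ h₃ V₂)
    (φ : ↥V₁.adelicFin ≃* ↥V₂.adelicFin) (eL : HodgeCM.Level V₁ ≃o HodgeCM.Level V₂) (eC : T₁.Char ≃ T₂.Char)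
    (eH : T₁.H ≃ₛₗ[σ] T₂.H)
    (eW : ∀ K : HodgeCM.Level V₁,
      (picardCMUniverse hHD hI h₁ h₃).CohC ((picardCMUniverse hHD hI h₁ h₃).pms L₁ ι₁ V₁ K) 1 ≃ₛₗ[σ]
        (picardCMUniverse hHD hI h₁ h₃).CohC ((picardCMUniverse hHD hI h₁ h₃).pms L₂ ι₂ V₂ (eL K)) 1)
    (hK : ∀ K : HodgeCM.Level V₁, (eL K).K = K.K.map φ.toMonoidHom)
    (heH : ∀ (g : ↥V₁.adelicFin) (x : T₁.H),
      eH (MonoidAlgebra.of ℂ ↥V₁.adelicFin g • x) = MonoidAlgebra.of ℂ ↥V₂.adelicFin (φ g) • eH x)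
    (hPhi : ∀ μ : T₁.Char, T₁.PhiMu μ ↔ T₂.PhiMu (eC μ))
    (hblock : ∀ μ : T₁.Char, (T₁.block μ).map (eH : T₁.H →ₛₗ[σ] T₂.H) = T₂.block (eC μ))
    (hres : ∀ (K : HodgeCM.Level V₁) (x : T₁.H), eW K (T₁.res K x) = T₂.res (eL K) (eH x))
    (hcm : ∀ (K : HodgeCM.Level V₁) (μ : T₁.Char), T₂.cmClasses (eL K) (eC μ) = eW K '' T₁.cmClasses K μ) :
    T₁.Thm418C ↔ T₂.Thm418C :=
  thm418Combined_iff_of_semilinearTransport T₁.toLiuAlbaneseModuleDatum T₂.toLiuAlbaneseModuleDatum T₁.res T₁.cmClasses T₂.res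
    T₂.cmClasses φ eL eC eH eW hK heH hPhi hblock hres hcm

omit [RingHomInvPair σ' σ] in
/-- **`Thm418C` transports along a SEMILINEAR package (one-sided, the consumer's direction «carry `Thm418C` from the pin `(V₂, ι₂)`
back to `(V₁, ι₁)`»).**  Only maps OUT OF the `(V₁, ι₁)`-side are needed, with the weakest laws of
`thm418Combined_of_semilinearTransport`. [folklore] -/
theorem thm418C_of_semilinearTransport {L₁ L₂ : HodgeCM.CMField} {ι₁ : (L₁ : Type) →+* ℂ} {ι₂ : (L₂ : Type) →+* ℂ}
    {V₁ : HodgeCM.HermSpace3 L₁ ι₁} {V₂ : HodgeCM.HermSpace3 L₂ ι₂}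
    (T₁ : LiuDictionary hHD hI h₁ h₃ V₁) (T₂ : LiuDictionary hHD hI h₁ h₃ V₂)
    (φ : ↥V₁.adelicFin → ↥V₂.adelicFin) (eL : HodgeCM.Level V₁ → HodgeCM.Level V₂) (eC : T₁.Char → T₂.Char)
    (eH : T₁.H →ₛₗ[σ] T₂.H)
    (eW : ∀ K : HodgeCM.Level V₁,
      (picardCMUniverse hHD hI h₁ h₃).CohC ((picardCMUniverse hHD hI h₁ h₃).pms L₁ ι₁ V₁ K) 1 →ₛₗ[σ]
        (picardCMUniverse hHD hI h₁ h₃).CohC ((picardCMUniverse hHD hI h₁ h₃).pms L₂ ι₂ V₂ (eL K)) 1)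
    (hcof : ∀ K₀' : HodgeCM.Level V₂, ∃ K₀ : HodgeCM.Level V₁, ∀ K ≤ K₀, eL K ≤ K₀')
    (hK : ∀ (K : HodgeCM.Level V₁), ∀ k' ∈ (eL K).K, ∃ k ∈ K.K, φ k = k')
    (heH : ∀ (K : HodgeCM.Level V₁), ∀ k ∈ K.K, ∀ x : T₁.H,
      eH (MonoidAlgebra.of ℂ ↥V₁.adelicFin k • x) = MonoidAlgebra.of ℂ ↥V₂.adelicFin (φ k) • eH x)
    (hPhi : ∀ μ : T₁.Char, T₁.PhiMu μ → T₂.PhiMu (eC μ))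
    (hblock : ∀ μ : T₁.Char, (T₁.block μ).map eH ≤ T₂.block (eC μ))
    (hres : ∀ (K : HodgeCM.Level V₁) (x : T₁.H), eW K (T₁.res K x) = T₂.res (eL K) (eH x))
    (hW : ∀ K : HodgeCM.Level V₁, Function.Injective (eW K))
    (hcm : ∀ (K : HodgeCM.Level V₁) (μ : T₁.Char), T₂.cmClasses (eL K) (eC μ) ⊆ eW K '' T₁.cmClasses K μ)
    (h : T₂.Thm418C) : T₁.Thm418C :=
  thm418Combined_of_semilinearTransport T₁.toLiuAlbaneseModuleDatum T₂.toLiuAlbaneseModuleDatum T₁.res T₁.cmClasses T₂.res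
    T₂.cmClasses φ eL eC eH eW hcof hK heH hPhi hblock hres hW hcm h

/-- **`Thm418C` transports along a SEMILINEAR package ON ONE HERMITIAN SPACE** (the shape of PROPOSAL T: a dictionary `T₁` and a second
dictionary `T₂` on the SAME `V` — e.g. a re-keyed one — related by a `G`-EQUIVARIANT `σ`-semilinear automorphism of the tower; `φ = id`,
`eL = id`): `T₁.Thm418C ↔ T₂.Thm418C` along a character bijection `eC` with `T₁.PhiMu μ ↔ T₂.PhiMu (eC μ)`, `eH : T₁.H ≃ₛₗ[σ] T₂.H`
with `eH (g • x) = g • eH x` and `eH (T₁.block μ) = T₂.block (eC μ)`, and `σ`-semilinear automorphisms `eW K` of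
`H¹(P_K; ℂ) = ℂ ⊗_ℚ H¹(P_K; ℚ)` with `eW K ∘ T₁.res K = T₂.res K ∘ eH` and `T₂.cmClasses K (eC μ) = eW K '' T₁.cmClasses K μ`.  At
`σ = starRingEnd ℂ`, `eH = eW K = F∞ = conj ⊗ id` these binders are PROPOSAL T's sub-lemmas (T1) `heH` ∕ `hres`, (T2) `eC` ∕ `hPhi`,
(T3′) `hcm`, (T4) `hblock`; nothing of them is assumed here. [folklore] -/
theorem thm418C_iff_of_semilinearTransport_samePin {L : HodgeCM.CMField} {ι₁ : (L : Type) →+* ℂ} {V : HodgeCM.HermSpace3 L ι₁}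
    (T₁ T₂ : LiuDictionary hHD hI h₁ h₃ V) (eC : T₁.Char ≃ T₂.Char) (eH : T₁.H ≃ₛₗ[σ] T₂.H)
    (eW : ∀ K : HodgeCM.Level V,
      (picardCMUniverse hHD hI h₁ h₃).CohC ((picardCMUniverse hHD hI h₁ h₃).pms L ι₁ V K) 1 ≃ₛₗ[σ]
        (picardCMUniverse hHD hI h₁ h₃).CohC ((picardCMUniverse hHD hI h₁ h₃).pms L ι₁ V K) 1)
    (heH : ∀ (g : ↥V.adelicFin) (x : T₁.H),
      eH (MonoidAlgebra.of ℂ ↥V.adelicFin g • x) = MonoidAlgebra.of ℂ ↥V.adelicFin g • eH x)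
    (hPhi : ∀ μ : T₁.Char, T₁.PhiMu μ ↔ T₂.PhiMu (eC μ))
    (hblock : ∀ μ : T₁.Char, (T₁.block μ).map (eH : T₁.H →ₛₗ[σ] T₂.H) = T₂.block (eC μ))
    (hres : ∀ (K : HodgeCM.Level V) (x : T₁.H), eW K (T₁.res K x) = T₂.res K (eH x))
    (hcm : ∀ (K : HodgeCM.Level V) (μ : T₁.Char), T₂.cmClasses K (eC μ) = eW K '' T₁.cmClasses K μ) :
    T₁.Thm418C ↔ T₂.Thm418C :=
  thm418C_iff_of_semilinearTransport T₁ T₂ (MulEquiv.refl _) (OrderIso.refl _) eC eH eW (fun K => by ext g; simp)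
    (fun g x => heH g x) hPhi hblock (fun K x => hres K x) hcm

end Summit.HodgeConjecture.CorCM.D2Bridge

end
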